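import Literature.MathematicalPhysics.QuantumFieldTheory.Balaban1983to89.B9Eq3105OfLocalInverseQ
import Literature.MathematicalPhysics.QuantumFieldTheory.Balaban1983to89.Node00.OpsYCubeDirInverse

/-!
# NODE 00 — THE DIRICHLET BOND-SECTOR INVERSE `G_□(U) = (Ω₀(Δ_a[G′_□](U))Ω₀)⁻¹` OF [B9] p. 409 l. 3–5 ∕ (3.105) at def-Y's letters (`GDirBY`)

[B9] p. 408 L40 – p. 409 L5: *"Let us take a cube `□ ∈ 𝒟_j` and let us define a sequence `{Ω_n(□)}_{n=0,…,j+1}` of domains … The operators constructed for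
this sequence, which we denote by `G′_□(U)`, `C_□(U) = (Q′(U)G′_□²(U)Q′*(U))⁻¹`, `G_□(U)`, satisfy all the inequalities of Theorems 3.1–3.3
correspondingly."*; p. 414 (3.105): *"`Δ_aG₀ = I − Σ_□ K(h_□)G_□h_□ − Σ_□ (1 − ζ_□)DPD*h_□G_□h_□ − Σ_□ ζ_□(DPD* − DP_□D*)h_□G_□h_□ − Σ_□ ζ_□P_□(∂h_□)G_□h_□ = I − R`"*;
p. 415: *"`ζ_□DG′_□Q′*C_□Q′G′_□D*h_□G_□h_□ = ζ_□DP_□D*h_□G_□h_□`"* (so `P_□ = P[G′_□] = G′_□Q′*C_□Q′G′_□`); p. 394 L24–33 (the Dirichlet convention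
`Δ↾Ω₀ = Ω₀ΔΩ₀`, *"They depend on the configuration `U` restricted to `Ω₀`"*).

THE BOND-SECTOR TWIN OF `Node00.OpsYCubeDirInverse` (the site letter `G′_□ = GpDirY`), asked BY NAME by the N06 junction (dag-n06-d g32 (B-P4), bus l. 12595):
print's `G_□(U)` is (3.26)–(3.27) FOR THE SEQUENCE `{Ω_n(□)}` — the inverse of `Δ_a(U) = Δ_loc(U) − DP(U)D*` with the sequence's `G′_□` in the projection
term (`P_□ = P[G′_□]`), Dirichlet data outside `Ω₀(□)`.  At def-Y's letters with the averaging pair as a parameter (`Node00.OpsYSectDQ.deltaAQY`,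
`B9Eq3105OfLocalInverseQ.deltaLocQY = Δ_loc[𝔮]`) this is `G_□(U) = dirInvY 𝟙_B (Δ_loc[𝔮](U) − Pl_□(U))` for a bond set `B = Ω₀(□)` and a nonlocal letter
`Pl_□` (print: `Pl_□ = DP_□D* = DPDsY parS G′_□`, §3 (c-2)), and THEN the local-inverse law `M_h(Δ_loc[𝔮] − Pl_□)G_□M_h = M_h²` of the (3.105) bookkeeping
(`B9Eq3105OfLocalInverseQ.eq3105Q_hT_ofLocalInverse`, hypothesis `hloc`) is an exact algebraic identity for every cut-off `h` supported in `B`, under the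
regime hypothesis `IsUnit (Ω₀(Δ_loc[𝔮] − Pl_□)Ω₀ + 1 − Ω₀)` (Theorems 3.1–3.3 ∕ Cor. 3.6 for the sequence — DISPLAYED, never proved here).

* §1 (any finite index `X`: sites, fine bonds, index bonds alike) the indicator cut-off `indFnY B = 𝟙_B`, the projection `indProjY B = M_{𝟙_B}`
  (`cubeProjY i D = indProjY D` by `rfl`), idempotence, the bridges `M_h 𝟙_B = M_h = 𝟙_B M_h` for `supp h ⊆ B`, congruence of compressions, `indProjY B = (𝟙_B)♯`.
* §2 (generic `T : Module.End ℂ (X → 𝔸)`) the law set of the Dirichlet local inverse `dirInvY (indProjY B) T`: support, vanishing off `B`, dependence on `λ↾B`,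
  the four inverse laws under `IsUnit (dirPadY (indProjY B) T)`, ★ THE LOCAL-INVERSE LAWS `M_h T G M_h = M_h² = M_h G T M_h` for `supp h ⊆ B`, locality
  (`T ↦ dirInvY 𝟙_B T` reads `T` only through `𝟙_B T 𝟙_B`), and THE LIFT CLAUSE: `T = M♯` with a real `K`, `M|_{B×B}K|_{B×B} = 1` ⇒ `IsUnit (dirPadY 𝟙_B M♯)`,
  `dirInvY 𝟙_B M♯ = (𝟙_B K 𝟙_B)♯` (FILE `OpsYCubeDirInverse` §1 ∕ §5 one level up, by name).
* §3 ★★ THE NAMED BOND LETTER `GDirBY i 𝔮 𝔮s Pl B : BondOpY` (+ regime object `padDeltaLocBY`), its laws as instances of §2, ★★ `hloc_GDirBY` ∕ `hlocT_GDirBY`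
  = the `hloc` ∕ `hlocT` hypotheses of `eq3105Q_hT_ofLocalInverse` ∕ `eq3105QT_hT_ofLocalInverse` DISCHARGED, hence ★★★ (3.105) AND ITS TRANSPOSE AT PRINT's `G_□(U)`
  with `E_□ ≡ 0` (`eq3105Q_hT_GDirBY`, `eq3105QT_hT_GDirBY`; at the print pin `Pl_□ = DPDsY parS G′_□`, `P₁ = P1Y`: `eq3105Q_hT_GDirBY_DPDsY`), the helper
  `bondsOverY i S` (bonds with source in a site set) fed by the site-support rows `∀ z, h z ≠ 0 → z ∈ S`, locality in `U`, (c-2) the (3.27)-for-the-sequence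
  face `GDirBY i 𝔮 𝔮s (DPDsY i parS Gp) B U = dirInvY 𝟙_B (Δ_a[𝔮][Gp](U))`, and (c-1) THE `U = 1` CLAUSE under a DISPLAYED matrix reading
  `Δ_loc[𝔮](1) − Pl(1) = M♯` (the `U = 1` rows of `∂, ∂*, Q, Pl` are the N06 campaign's currency, not restated): `G_□(1) = (𝟙_B K 𝟙_B)♯`.

Exact algebra and bookkeeping only: no estimate, no Cor. 3.6, no choice of `B = Ω₀(□)` or of `Pl_□` (binders; the junction pins them), no kernel-agreement
geometry (`hOagrA` stays junction-side).  Gauge group SU(N) only through def-Y's carriers; no continuum limit, no OS axioms, no mass gap, no claim on the Clay problem.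
-/

namespace Literature.MathematicalPhysics.QuantumFieldTheory.Balaban1983to89.Node00.OpsYCubeDirInverseBond

open B6KLevelCensusIndexV1 (KIdx)
open B6Cover236MultiLevelBlocks (cubes)
open B9Thm37CubeCoverCommutators (cutMulY cutMulY_apply cutMulY_mul cutMulY_one hTY sum_hTY_sq)
open B9Eq3104CutoffCommutators (hBdY hBdY_apply DPDsY P1Y DPDsY_comp_cutMulY)
open B9Eq3105OfLocalInverseQ (deltaLocQY KhBQY deltaAQY_eq_loc_sub eq3105Q_hT_ofLocalInverse eq3105QT_hT_ofLocalInverse)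
open B9Cor35AtOneInverseLetters (eq_liftOpY_of_liftY eq_liftOpY_of_ringInverse isUnit_of_liftY_clause_mulVec liftOpY_mul)
open B9Eq326AtOneChart (liftY_sub)
open OpsYNablaBridge (chartY)
open OpsYQLetter (QLetterY QsLetterY)
open OpsYLocalInverse
open OpsYCubeDirInverse (indDiagY indDiagY_mul_indDiagY indDiagY_mulVec_apply compr_mulVec_apply compr_mul_compr_eq_indDiagY mul_dirPadY_mul
  dirPadY_mul_dirPadY_eq_one isUnit_dirPadY_of_compr)
open scoped Matrix

variable {𝔸 : Type} [NormedRing 𝔸] [NormedAlgebra ℂ 𝔸] [CompleteSpace 𝔸]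

/-! ## §1 The indicator projection on functions of a finite index -/

section Ind

variable {X : Type} [DecidableEq X]

/-- the indicator `𝟙_B` of a finite set of indices, as a real cut-off. [cite: Balaban1985BackgroundPropagators, p.394 («Ω₀ denotes a characteristic function of Ω₀»), bookkeeping] -/
noncomputable def indFnY (B : Finset X) : X → ℝ := fun x => if x ∈ B then 1 else 0

omit [DecidableEq X] in
/-- the indicator, evaluated. [cite: Balaban1985BackgroundPropagators, p.394, bookkeeping] -/
theorem indFnY_apply [DecidableEq X] (B : Finset X) (x : X) : indFnY B x = if x ∈ B then 1 else 0 := rfl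

/-- `𝟙_B² = 𝟙_B`. [cite: Balaban1985BackgroundPropagators, p.394, bookkeeping] -/
theorem indFnY_mul_self (B : Finset X) (x : X) : indFnY B x * indFnY B x = indFnY B x := by
  rw [indFnY_apply]
  split_ifs <;> simp

/-- **the projection `Ω₀ = M_{𝟙_B}`** onto the `𝔸`-valued functions supported in `B` (Dirichlet data outside `B`), on ANY finite index type (sites, fine bonds, index bonds).
[cite: Balaban1985BackgroundPropagators, p.394 («Δ′_a↾Ω₀ = Ω₀Δ′_aΩ₀»), pp.408–409] -/
noncomputable def indProjY (B : Finset X) : Module.End ℂ (X → 𝔸) := cutMulY (indFnY B)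

omit [CompleteSpace 𝔸] in
/-- the projection, evaluated. [cite: Balaban1985BackgroundPropagators, p.394, bookkeeping] -/
theorem indProjY_apply (B : Finset X) (Λ : X → 𝔸) (x : X) : indProjY (𝔸 := 𝔸) B Λ x = if x ∈ B then Λ x else 0 := by
  rw [indProjY, cutMulY_apply, indFnY_apply]
  split_ifs <;> simp

omit [CompleteSpace 𝔸] in
/-- `Ω₀² = Ω₀`. [cite: Balaban1985BackgroundPropagators, p.394, bookkeeping] -/
theorem indProjY_mul_indProjY (B : Finset X) : indProjY (𝔸 := 𝔸) B * indProjY B = indProjY B := by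
  rw [indProjY, cutMulY_mul]
  exact congrArg cutMulY (funext fun x => indFnY_mul_self B x)

omit [CompleteSpace 𝔸] in
/-- the whole index set projects as the identity. [cite: Balaban1985BackgroundPropagators, p.394, bookkeeping] -/
theorem indProjY_univ [Fintype X] : indProjY (𝔸 := 𝔸) (Finset.univ : Finset X) = 1 := by
  rw [indProjY, ← cutMulY_one]
  exact congrArg cutMulY (funext fun x => if_pos (Finset.mem_univ x))

omit [CompleteSpace 𝔸] in
/-- a cut-off supported in `B` absorbs the projection on the right: `M_h Ω₀ = M_h`. [cite: Balaban1985BackgroundPropagators, (3.87) p.409, p.394, bookkeeping] -/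
theorem cutMulY_mul_indProjY (h : X → ℝ) {B : Finset X} (hB : ∀ x, h x ≠ 0 → x ∈ B) : cutMulY (𝔸 := 𝔸) h * indProjY B = cutMulY h := by
  rw [indProjY, cutMulY_mul]
  refine congrArg cutMulY (funext fun x => ?_)
  by_cases hx : h x = 0
  · rw [hx, zero_mul]
  · rw [indFnY_apply, if_pos (hB x hx), mul_one]

omit [CompleteSpace 𝔸] in
/-- and on the left: `Ω₀ M_h = M_h`. [cite: Balaban1985BackgroundPropagators, (3.87) p.409, p.394, bookkeeping] -/
theorem indProjY_mul_cutMulY (h : X → ℝ) {B : Finset X} (hB : ∀ x, h x ≠ 0 → x ∈ B) : indProjY (𝔸 := 𝔸) B * cutMulY h = cutMulY h := by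
  rw [indProjY, cutMulY_mul]
  refine congrArg cutMulY (funext fun x => ?_)
  by_cases hx : h x = 0
  · rw [hx, mul_zero]
  · rw [indFnY_apply, if_pos (hB x hx), one_mul]

omit [CompleteSpace 𝔸] in
/-- compressions `Ω₀TΩ₀` agree as soon as `T`, `T′` agree ON `B` on functions SUPPORTED IN `B`. [cite: Balaban1985BackgroundPropagators, p.394 («They depend on the configuration U restricted to Ω₀»), bookkeeping] -/
theorem compr_congr_of_apply (B : Finset X) {T T' : Module.End ℂ (X → 𝔸)}
    (h : ∀ Λ : X → 𝔸, (∀ x, x ∉ B → Λ x = 0) → ∀ x ∈ B, T Λ x = T' Λ x) :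
    indProjY B * T * indProjY B = indProjY B * T' * indProjY B := by
  refine LinearMap.ext fun Λ => funext fun x => ?_
  simp only [Module.End.mul_apply]
  rw [indProjY_apply, indProjY_apply]
  split_ifs with hx
  · exact h _ (fun y hy => by rw [indProjY_apply, if_neg hy]) x hx
  · rfl

omit [CompleteSpace 𝔸] in
/-- the projection on product-form arguments: `Ω₀(f ⊗ E) = (𝟙_B f) ⊗ E`. [cite: Balaban1985BackgroundPropagators, p.394, bookkeeping] -/
theorem indProjY_liftY [Fintype X] (B : Finset X) (f : X → ℝ) (E : 𝔸) : indProjY B (liftY f E) = liftY (indDiagY B *ᵥ f) E := by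
  funext x
  rw [indProjY_apply, liftY_apply, liftY_apply, indDiagY_mulVec_apply]
  split_ifs <;> simp

omit [CompleteSpace 𝔸] in
/-- so `Ω₀` IS the lift of the indicator diagonal `𝟙_B`. [cite: Balaban1985BackgroundPropagators, p.394, bookkeeping] -/
theorem indProjY_eq_liftOpY [Fintype X] (B : Finset X) : indProjY (𝔸 := 𝔸) B = liftOpY 𝔸 (indDiagY B) :=
  eq_liftOpY_of_liftY (indProjY_liftY B)

end Ind

/-! ## §2 The Dirichlet local inverse `dirInvY 𝟙_B T` of an operator on functions of a finite index: laws -/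

section DirInv

variable {X : Type} [DecidableEq X] (B : Finset X)

omit [CompleteSpace 𝔸] in
/-- support on the left: `Ω₀ G = G`. [cite: Balaban1985BackgroundPropagators, p.394 («Ω₀Δ′_aΩ₀»), pp.408–409] -/
theorem indProjY_mul_dirInvY (T : Module.End ℂ (X → 𝔸)) : indProjY B * dirInvY (indProjY B) T = dirInvY (indProjY B) T :=
  mul_dirInvY (indProjY_mul_indProjY B) T

omit [CompleteSpace 𝔸] in
/-- and on the right: `G Ω₀ = G`. [cite: Balaban1985BackgroundPropagators, p.394 («Ω₀Δ′_aΩ₀»), pp.408–409] -/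
theorem dirInvY_mul_indProjY (T : Module.End ℂ (X → 𝔸)) : dirInvY (indProjY B) T * indProjY B = dirInvY (indProjY B) T :=
  dirInvY_mul (indProjY_mul_indProjY B) T

omit [CompleteSpace 𝔸] in
/-- hence `Gλ` vanishes off `B`. [cite: Balaban1985BackgroundPropagators, p.394 (Dirichlet boundary conditions)] -/
theorem dirInvY_apply_eq_zero (T : Module.End ℂ (X → 𝔸)) (Λ : X → 𝔸) {x : X} (hx : x ∉ B) : dirInvY (indProjY B) T Λ x = 0 := by
  rw [← indProjY_mul_dirInvY, Module.End.mul_apply, indProjY_apply, if_neg hx]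

omit [CompleteSpace 𝔸] in
/-- and `Gλ` depends on `λ` only on `B`. [cite: Balaban1985BackgroundPropagators, p.394 (Dirichlet boundary conditions)] -/
theorem dirInvY_apply_congr (T : Module.End ℂ (X → 𝔸)) {Λ Λ' : X → 𝔸} (h : ∀ x ∈ B, Λ x = Λ' x) :
    dirInvY (indProjY B) T Λ = dirInvY (indProjY B) T Λ' := by
  have hPΛ : indProjY (𝔸 := 𝔸) B Λ = indProjY B Λ' := funext fun x => by
    rw [indProjY_apply, indProjY_apply]
    split_ifs with hx
    · exact h x hx
    · rfl
  rw [← dirInvY_mul_indProjY, Module.End.mul_apply, Module.End.mul_apply, hPΛ]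

omit [CompleteSpace 𝔸] in
/-- off the unit locus the letter is `0` (`Ring.inverse`). [cite: Balaban1985BackgroundPropagators, Cor. 3.6 p.408 (the regime), bookkeeping] -/
theorem dirInvY_of_not_isUnit' {T : Module.End ℂ (X → 𝔸)} (hU : ¬ IsUnit (dirPadY (indProjY B) T)) : dirInvY (indProjY B) T = 0 :=
  dirInvY_of_not_isUnit hU

omit [CompleteSpace 𝔸] in
/-- inverse law: `(Ω₀TΩ₀)·G = Ω₀`. [cite: Balaban1985BackgroundPropagators, p.394 («Its inverse is denoted by G′»), pp.408–409] -/
theorem compr_mul_dirInvY' {T : Module.End ℂ (X → 𝔸)} (hU : IsUnit (dirPadY (indProjY B) T)) :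
    indProjY B * T * indProjY B * dirInvY (indProjY B) T = indProjY B :=
  compr_mul_dirInvY (indProjY_mul_indProjY B) hU

omit [CompleteSpace 𝔸] in
/-- inverse law: `G·(Ω₀TΩ₀) = Ω₀`. [cite: Balaban1985BackgroundPropagators, p.394, pp.408–409] -/
theorem dirInvY_mul_compr' {T : Module.End ℂ (X → 𝔸)} (hU : IsUnit (dirPadY (indProjY B) T)) :
    dirInvY (indProjY B) T * (indProjY B * T * indProjY B) = indProjY B :=
  dirInvY_mul_compr (indProjY_mul_indProjY B) hU

omit [CompleteSpace 𝔸] in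
/-- inverse law: `Ω₀·T·G = Ω₀`. [cite: Balaban1985BackgroundPropagators, p.394, (3.88) p.409] -/
theorem indProjY_mul_op_mul_dirInvY {T : Module.End ℂ (X → 𝔸)} (hU : IsUnit (dirPadY (indProjY B) T)) :
    indProjY B * T * dirInvY (indProjY B) T = indProjY B :=
  P_mul_T_mul_dirInvY (indProjY_mul_indProjY B) hU

omit [CompleteSpace 𝔸] in
/-- inverse law (transposed): `G·T·Ω₀ = Ω₀`. [cite: Balaban1985BackgroundPropagators, p.394, (3.88) p.409] -/
theorem dirInvY_mul_op_mul_indProjY {T : Module.End ℂ (X → 𝔸)} (hU : IsUnit (dirPadY (indProjY B) T)) :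
    dirInvY (indProjY B) T * T * indProjY B = indProjY B := by
  calc dirInvY (indProjY B) T * T * indProjY B
      = dirInvY (indProjY B) T * indProjY B * T * indProjY B := by rw [dirInvY_mul_indProjY]
    _ = dirInvY (indProjY B) T * (indProjY B * T * indProjY B) := by simp only [mul_assoc]
    _ = indProjY B := dirInvY_mul_compr (indProjY_mul_indProjY B) hU

omit [CompleteSpace 𝔸] in
/-- ★ **THE LOCAL-INVERSE LAW** for a cut-off supported in `B`: `M_h T G M_h = M_h²` — the law of `G_□` the (3.105) bookkeeping consumes (`eq3105Q_hT_ofLocalInverse`, `hloc`).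
[cite: Balaban1985BackgroundPropagators, (3.87)–(3.88) p.409, (3.105) p.414] -/
theorem cutMulY_op_dirInvY_cutMulY {T : Module.End ℂ (X → 𝔸)} (hU : IsUnit (dirPadY (indProjY B) T)) (h : X → ℝ) (hB : ∀ x, h x ≠ 0 → x ∈ B) :
    cutMulY h * T * dirInvY (indProjY B) T * cutMulY h = cutMulY h * cutMulY h := by
  calc cutMulY h * T * dirInvY (indProjY B) T * cutMulY h
      = cutMulY h * indProjY B * T * dirInvY (indProjY B) T * cutMulY h := by rw [cutMulY_mul_indProjY h hB]
    _ = cutMulY h * (indProjY B * T * dirInvY (indProjY B) T) * cutMulY h := by simp only [mul_assoc]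
    _ = cutMulY h * indProjY B * cutMulY h := by rw [indProjY_mul_op_mul_dirInvY B hU]
    _ = cutMulY h * cutMulY h := by rw [cutMulY_mul_indProjY h hB]

omit [CompleteSpace 𝔸] in
/-- ★ **THE TRANSPOSED LOCAL-INVERSE LAW**: `M_h G T M_h = M_h²` (`eq3105QT_hT_ofLocalInverse`, `hlocT`). (transposed reading — bookkeeping)
[cite: Balaban1985BackgroundPropagators, (3.87)–(3.88) p.409, (3.105) p.414] -/
theorem cutMulY_dirInvY_op_cutMulY {T : Module.End ℂ (X → 𝔸)} (hU : IsUnit (dirPadY (indProjY B) T)) (h : X → ℝ) (hB : ∀ x, h x ≠ 0 → x ∈ B) :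
    cutMulY h * dirInvY (indProjY B) T * T * cutMulY h = cutMulY h * cutMulY h := by
  calc cutMulY h * dirInvY (indProjY B) T * T * cutMulY h
      = cutMulY h * dirInvY (indProjY B) T * T * (indProjY B * cutMulY h) := by rw [indProjY_mul_cutMulY h hB]
    _ = cutMulY h * (dirInvY (indProjY B) T * T * indProjY B) * cutMulY h := by simp only [mul_assoc]
    _ = cutMulY h * indProjY B * cutMulY h := by rw [dirInvY_mul_op_mul_indProjY B hU]
    _ = cutMulY h * cutMulY h := by rw [cutMulY_mul_indProjY h hB]

omit [CompleteSpace 𝔸] in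
/-- LOCALITY: the letter reads `T` only through its compression `Ω₀TΩ₀`, i.e. through `Tλ↾B` for `λ` supported in `B`.
[cite: Balaban1985BackgroundPropagators, p.394 («They depend on the configuration U restricted to Ω₀»), p.410] -/
theorem dirInvY_congr_of_apply {T T' : Module.End ℂ (X → 𝔸)} (h : ∀ Λ : X → 𝔸, (∀ x, x ∉ B → Λ x = 0) → ∀ x ∈ B, T Λ x = T' Λ x) :
    dirInvY (indProjY B) T = dirInvY (indProjY B) T' :=
  dirInvY_congr (compr_congr_of_apply B h)

omit [CompleteSpace 𝔸] in
/-- and so does the padded compression. [cite: Balaban1985BackgroundPropagators, p.394, bookkeeping] -/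
theorem dirPadY_congr_of_apply {T T' : Module.End ℂ (X → 𝔸)} (h : ∀ Λ : X → 𝔸, (∀ x, x ∉ B → Λ x = 0) → ∀ x ∈ B, T Λ x = T' Λ x) :
    dirPadY (indProjY B) T = dirPadY (indProjY B) T' := by
  rw [dirPadY, dirPadY, compr_congr_of_apply B h]

/-! ### The lift clause: `T = M♯` for a real matrix `M` whose compression to `B` a real `K` inverts -/

omit [CompleteSpace 𝔸] in
/-- the padded compression of a lifted matrix on product-form arguments: `(Ω₀M♯Ω₀ + 1 − Ω₀)(f ⊗ E) = (dirPadY 𝟙_B M f) ⊗ E`.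
[cite: Balaban1985BackgroundPropagators, p.395 («It coincides with Δ_a in (2.19) if U = 1»), p.394, bookkeeping] -/
theorem dirPadY_indProjY_liftOpY_liftY [Fintype X] (M : Matrix X X ℝ) (f : X → ℝ) (E : 𝔸) :
    dirPadY (indProjY B) (liftOpY 𝔸 M) (liftY f E) = liftY (dirPadY (indDiagY B) M *ᵥ f) E := by
  rw [dirPadY, dirPadY, LinearMap.add_apply, LinearMap.sub_apply, Module.End.one_apply, Module.End.mul_apply, Module.End.mul_apply,
    indProjY_liftY, liftOpY_liftY, indProjY_liftY, ← liftY_sub, ← liftY_add, Matrix.add_mulVec, Matrix.sub_mulVec,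
    Matrix.one_mulVec, ← Matrix.mulVec_mulVec, ← Matrix.mulVec_mulVec]

omit [CompleteSpace 𝔸] in
/-- hence the padded compression of a lift IS the lift of the padded matrix. [cite: Balaban1985BackgroundPropagators, p.395, bookkeeping] -/
theorem dirPadY_indProjY_liftOpY [Fintype X] (M : Matrix X X ℝ) :
    dirPadY (indProjY (𝔸 := 𝔸) B) (liftOpY 𝔸 M) = liftOpY 𝔸 (dirPadY (indDiagY B) M) :=
  eq_liftOpY_of_liftY (dirPadY_indProjY_liftOpY_liftY B M)

omit [CompleteSpace 𝔸] in
/-- ★ the regime of a lift from a compressed real inverse: `M|_{B×B}K|_{B×B} = 1` ⇒ `IsUnit (Ω₀M♯Ω₀ + 1 − Ω₀)`.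
[cite: Balaban1985BackgroundPropagators, p.394 («Its inverse is denoted by G′»), Cor. 3.5 p.407; Balaban1983RegularityDecay, (2.42) p.584] -/
theorem isUnit_dirPadY_indProjY_liftOpY [Fintype X] {M K : Matrix X X ℝ}
    (hK : M.submatrix (fun v : ↥B => (v : X)) (fun v : ↥B => (v : X)) * K.submatrix (fun v : ↥B => (v : X)) (fun v : ↥B => (v : X)) = 1) :
    IsUnit (dirPadY (indProjY (𝔸 := 𝔸) B) (liftOpY 𝔸 M)) :=
  isUnit_of_liftY_clause_mulVec
    (isUnit_dirPadY_of_compr (indDiagY_mul_indDiagY B) (compr_mul_compr_eq_indDiagY B hK) (compr_mul_compr_eq_indDiagY B (mul_eq_one_comm.1 hK)))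
    (dirPadY_indProjY_liftOpY_liftY B M)

omit [CompleteSpace 𝔸] in
/-- ★★ **THE LIFT CLAUSE**: `dirInvY 𝟙_B M♯ = (𝟙_B K 𝟙_B)♯` for ANY real `K` inverting the compression of `M` to `B`.
[cite: Balaban1985BackgroundPropagators, p.394, Cor. 3.5 p.407, pp.408–409; Balaban1983RegularityDecay, (2.42) p.584] -/
theorem dirInvY_indProjY_liftOpY [Fintype X] {M K : Matrix X X ℝ}
    (hK : M.submatrix (fun v : ↥B => (v : X)) (fun v : ↥B => (v : X)) * K.submatrix (fun v : ↥B => (v : X)) (fun v : ↥B => (v : X)) = 1) :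
    dirInvY (indProjY (𝔸 := 𝔸) B) (liftOpY 𝔸 M) = liftOpY 𝔸 (indDiagY B * K * indDiagY B) := by
  have hinv : Ring.inverse (dirPadY (indProjY (𝔸 := 𝔸) B) (liftOpY 𝔸 M)) = liftOpY 𝔸 (dirPadY (indDiagY B) K) :=
    eq_liftOpY_of_ringInverse rfl
      (dirPadY_mul_dirPadY_eq_one (indDiagY_mul_indDiagY B) (compr_mul_compr_eq_indDiagY B hK)) (dirPadY_indProjY_liftOpY_liftY B M)
  rw [dirInvY, hinv, indProjY_eq_liftOpY, Module.End.mul_eq_comp, Module.End.mul_eq_comp, ← liftOpY_mul, ← liftOpY_mul,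
    mul_dirPadY_mul (indDiagY_mul_indDiagY B)]

omit [CompleteSpace 𝔸] in
/-- its product-form reading: `dirInvY 𝟙_B M♯ (f ⊗ E)(x) = (Σ_{y∈B} K x y f y) E` on `B`, `0` off `B`.
[cite: Balaban1985BackgroundPropagators, p.394 (the Dirichlet inverse); Balaban1983RegularityDecay, (2.42) p.584] -/
theorem dirInvY_indProjY_liftOpY_liftY_apply [Fintype X] {M K : Matrix X X ℝ}
    (hK : M.submatrix (fun v : ↥B => (v : X)) (fun v : ↥B => (v : X)) * K.submatrix (fun v : ↥B => (v : X)) (fun v : ↥B => (v : X)) = 1)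
    (f : X → ℝ) (E : 𝔸) (x : X) :
    dirInvY (indProjY B) (liftOpY 𝔸 M) (liftY f E) x = if x ∈ B then (((∑ y ∈ B, K x y * f y : ℝ)) : ℂ) • E else 0 := by
  rw [dirInvY_indProjY_liftOpY B hK, liftOpY_liftY, liftY_apply, compr_mulVec_apply]
  split_ifs <;> simp

end DirInv

/-! ## §3 The bond-sector letter `G_□(U)` of p. 409 l. 3–5 ∕ (3.105) -/

section Bond

variable {d ℓ : ℕ} {hd : 1 ≤ d + 1} {hL : Odd (ℓ + 1) ∧ 1 < ℓ + 1} {b₀ b₁ : ℝ}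
variable (i : KIdx d ℓ hd hL b₀ b₁)

omit [CompleteSpace 𝔸] in
/-- dictionary: FILE `OpsYLocalInverse`'s site projection IS the indicator projection at the member's sites. [cite: Balaban1985BackgroundPropagators, p.394, dictionary] -/
theorem cubeProjY_eq_indProjY (D : Finset (SiteY i)) : cubeProjY (𝔸 := 𝔸) i D = indProjY D := rfl

/-- the fine bonds whose SOURCE site lies in a site set `S` (the bond reading `hBdY` of a site cut-off is supported there). [cite: Balaban1985BackgroundPropagators, (3.87) p.409, p.394, bookkeeping] -/
noncomputable def bondsOverY (S : Finset (SiteY i)) : Finset (FBondY i) := Finset.univ.filter fun b => chartY i b.src ∈ S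

/-- membership. [cite: Balaban1985BackgroundPropagators, (3.87) p.409, bookkeeping] -/
theorem mem_bondsOverY {S : Finset (SiteY i)} {b : FBondY i} : b ∈ bondsOverY i S ↔ chartY i b.src ∈ S := by
  simp [bondsOverY]

/-- the bridge from the site-support rows: `supp h ⊆ S` ⇒ the bond reading `hBdY h` is supported in `bondsOverY S`. [cite: Balaban1985BackgroundPropagators, (3.87) p.409, bookkeeping] -/
theorem mem_bondsOverY_of_hBdY_ne_zero {h : SiteY i → ℝ} {S : Finset (SiteY i)} (hS : ∀ z, h z ≠ 0 → z ∈ S) {b : FBondY i}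
    (hb : hBdY i h b ≠ 0) : b ∈ bondsOverY i S :=
  (mem_bondsOverY i).2 (hS _ hb)

/-- the PADDED COMPRESSION `Ω₀(Δ_loc[𝔮](U) − Pl_□(U))Ω₀ + (1 − Ω₀)` to the bond set `B = Ω₀(□)` — the regime object whose invertibility (Theorems 3.1–3.3 ∕ Cor. 3.6
for the sequence `{Ω_n(□)}`) is the HYPOTHESIS of every inverse identity below. [cite: Balaban1985BackgroundPropagators, p.409 l.3–5, Cor. 3.6 p.408, p.394] -/
noncomputable def padDeltaLocBY (𝔮 : QLetterY 𝔸 i) (𝔮s : QsLetterY 𝔸 i) (Pl : CfgY 𝔸 i → Module.End ℂ (FBondY i → 𝔸)) (B : Finset (FBondY i))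
    (U : CfgY 𝔸 i) : Module.End ℂ (FBondY i → 𝔸) :=
  dirPadY (indProjY B) (deltaLocQY i 𝔮 𝔮s U - Pl U)

/-- ★★ **THE DIRICHLET BOND-SECTOR INVERSE `G_□(U)`** of p. 409 l. 3–5: the inverse of `Δ_loc[𝔮](U) − Pl_□(U)` (`Pl_□ = DP_□D*`, (3.26) for the sequence) compressed
to the vector fields supported in `B = Ω₀(□)`, extended by `0` (`Ring.inverse`: `0` off the unit locus). [cite: Balaban1985BackgroundPropagators, p.409 l.3–5 («G_□(U)»), (3.26)–(3.27) p.395, (3.87) p.409, (3.105) p.414] -/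
noncomputable def GDirBY (𝔮 : QLetterY 𝔸 i) (𝔮s : QsLetterY 𝔸 i) (Pl : CfgY 𝔸 i → Module.End ℂ (FBondY i → 𝔸)) (B : Finset (FBondY i)) : BondOpY 𝔸 i :=
  fun U => dirInvY (indProjY B) (deltaLocQY i 𝔮 𝔮s U - Pl U)

variable (𝔮 : QLetterY 𝔸 i) (𝔮s : QsLetterY 𝔸 i)

/-- `G_□(U)`, unfolded. [cite: Balaban1985BackgroundPropagators, p.409 l.3–5, bookkeeping] -/
theorem GDirBY_def (Pl : CfgY 𝔸 i → Module.End ℂ (FBondY i → 𝔸)) (B : Finset (FBondY i)) (U : CfgY 𝔸 i) :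
    GDirBY i 𝔮 𝔮s Pl B U = indProjY B * Ring.inverse (padDeltaLocBY i 𝔮 𝔮s Pl B U) * indProjY B := rfl

/-- `G_□(U)` IS the generic Dirichlet local inverse of §2 at `T = Δ_loc[𝔮](U) − Pl_□(U)`. [cite: Balaban1985BackgroundPropagators, p.409 l.3–5, bookkeeping] -/
theorem GDirBY_apply_eq (Pl : CfgY 𝔸 i → Module.End ℂ (FBondY i → 𝔸)) (B : Finset (FBondY i)) (U : CfgY 𝔸 i) :
    GDirBY i 𝔮 𝔮s Pl B U = dirInvY (indProjY B) (deltaLocQY i 𝔮 𝔮s U - Pl U) := rfl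

/-- the regime object, unfolded. [cite: Balaban1985BackgroundPropagators, p.409 l.3–5, bookkeeping] -/
theorem padDeltaLocBY_eq (Pl : CfgY 𝔸 i → Module.End ℂ (FBondY i → 𝔸)) (B : Finset (FBondY i)) (U : CfgY 𝔸 i) :
    padDeltaLocBY i 𝔮 𝔮s Pl B U = dirPadY (indProjY B) (deltaLocQY i 𝔮 𝔮s U - Pl U) := rfl

/-- support on the left: `Ω₀ G_□ = G_□`. [cite: Balaban1985BackgroundPropagators, p.394 («Ω₀Δ′_aΩ₀»), p.409] -/
theorem indProjY_mul_GDirBY (Pl : CfgY 𝔸 i → Module.End ℂ (FBondY i → 𝔸)) (B : Finset (FBondY i)) (U : CfgY 𝔸 i) :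
    indProjY B * GDirBY i 𝔮 𝔮s Pl B U = GDirBY i 𝔮 𝔮s Pl B U :=
  indProjY_mul_dirInvY B _

/-- and on the right: `G_□ Ω₀ = G_□`. [cite: Balaban1985BackgroundPropagators, p.394, p.409] -/
theorem GDirBY_mul_indProjY (Pl : CfgY 𝔸 i → Module.End ℂ (FBondY i → 𝔸)) (B : Finset (FBondY i)) (U : CfgY 𝔸 i) :
    GDirBY i 𝔮 𝔮s Pl B U * indProjY B = GDirBY i 𝔮 𝔮s Pl B U :=
  dirInvY_mul_indProjY B _

/-- `G_□(U)A` vanishes off `B`. [cite: Balaban1985BackgroundPropagators, p.394 (Dirichlet boundary conditions), p.409] -/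
theorem GDirBY_apply_eq_zero (Pl : CfgY 𝔸 i → Module.End ℂ (FBondY i → 𝔸)) {B : Finset (FBondY i)} (U : CfgY 𝔸 i) (A : FBondY i → 𝔸)
    {b : FBondY i} (hb : b ∉ B) : GDirBY i 𝔮 𝔮s Pl B U A b = 0 :=
  dirInvY_apply_eq_zero B _ A hb

/-- `G_□(U)A` depends on `A` only on `B`. [cite: Balaban1985BackgroundPropagators, p.394 (Dirichlet boundary conditions), p.409] -/
theorem GDirBY_apply_congr (Pl : CfgY 𝔸 i → Module.End ℂ (FBondY i → 𝔸)) {B : Finset (FBondY i)} (U : CfgY 𝔸 i) {A A' : FBondY i → 𝔸}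
    (h : ∀ b ∈ B, A b = A' b) : GDirBY i 𝔮 𝔮s Pl B U A = GDirBY i 𝔮 𝔮s Pl B U A' :=
  dirInvY_apply_congr B _ h

/-- off the unit locus the letter is `0`. [cite: Balaban1985BackgroundPropagators, Cor. 3.6 p.408 (the regime), bookkeeping] -/
theorem GDirBY_of_not_isUnit (Pl : CfgY 𝔸 i → Module.End ℂ (FBondY i → 𝔸)) {B : Finset (FBondY i)} {U : CfgY 𝔸 i}
    (hU : ¬ IsUnit (padDeltaLocBY i 𝔮 𝔮s Pl B U)) : GDirBY i 𝔮 𝔮s Pl B U = 0 :=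
  dirInvY_of_not_isUnit hU

/-- inverse law: `(Ω₀(Δ_loc[𝔮] − Pl_□)Ω₀)·G_□ = Ω₀`. [cite: Balaban1985BackgroundPropagators, p.409 l.3–5, p.394] -/
theorem compr_mul_GDirBY (Pl : CfgY 𝔸 i → Module.End ℂ (FBondY i → 𝔸)) {B : Finset (FBondY i)} {U : CfgY 𝔸 i}
    (hU : IsUnit (padDeltaLocBY i 𝔮 𝔮s Pl B U)) :
    indProjY B * (deltaLocQY i 𝔮 𝔮s U - Pl U) * indProjY B * GDirBY i 𝔮 𝔮s Pl B U = indProjY B :=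
  compr_mul_dirInvY' B hU

/-- inverse law: `G_□·(Ω₀(Δ_loc[𝔮] − Pl_□)Ω₀) = Ω₀`. [cite: Balaban1985BackgroundPropagators, p.409 l.3–5, p.394] -/
theorem GDirBY_mul_compr (Pl : CfgY 𝔸 i → Module.End ℂ (FBondY i → 𝔸)) {B : Finset (FBondY i)} {U : CfgY 𝔸 i}
    (hU : IsUnit (padDeltaLocBY i 𝔮 𝔮s Pl B U)) :
    GDirBY i 𝔮 𝔮s Pl B U * (indProjY B * (deltaLocQY i 𝔮 𝔮s U - Pl U) * indProjY B) = indProjY B :=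
  dirInvY_mul_compr' B hU

/-- inverse law: `Ω₀(Δ_loc[𝔮] − Pl_□)G_□ = Ω₀`. [cite: Balaban1985BackgroundPropagators, p.409 l.3–5, (3.88) p.409] -/
theorem indProjY_mul_op_mul_GDirBY (Pl : CfgY 𝔸 i → Module.End ℂ (FBondY i → 𝔸)) {B : Finset (FBondY i)} {U : CfgY 𝔸 i}
    (hU : IsUnit (padDeltaLocBY i 𝔮 𝔮s Pl B U)) :
    indProjY B * (deltaLocQY i 𝔮 𝔮s U - Pl U) * GDirBY i 𝔮 𝔮s Pl B U = indProjY B :=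
  indProjY_mul_op_mul_dirInvY B hU

/-- inverse law (transposed): `G_□(Δ_loc[𝔮] − Pl_□)Ω₀ = Ω₀`. [cite: Balaban1985BackgroundPropagators, p.409 l.3–5, (3.88) p.409] -/
theorem GDirBY_mul_op_mul_indProjY (Pl : CfgY 𝔸 i → Module.End ℂ (FBondY i → 𝔸)) {B : Finset (FBondY i)} {U : CfgY 𝔸 i}
    (hU : IsUnit (padDeltaLocBY i 𝔮 𝔮s Pl B U)) :
    GDirBY i 𝔮 𝔮s Pl B U * (deltaLocQY i 𝔮 𝔮s U - Pl U) * indProjY B = indProjY B :=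
  dirInvY_mul_op_mul_indProjY B hU

/-- ★★ **`hloc` DISCHARGED**: for a site cut-off `h` whose bond reading is supported in `B`, `M_h(Δ_loc[𝔮](U) − Pl_□(U))G_□(U)M_h = M_h²` — literally the hypothesis
`hloc` of `B9Eq3105OfLocalInverseQ.eq3105Q_hT_ofLocalInverse` at `Gl_□ := G_□(U)`. [cite: Balaban1985BackgroundPropagators, (3.87)–(3.88) p.409, (3.105) p.414] -/
theorem hloc_GDirBY (Pl : CfgY 𝔸 i → Module.End ℂ (FBondY i → 𝔸)) {B : Finset (FBondY i)} {U : CfgY 𝔸 i}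
    (hU : IsUnit (padDeltaLocBY i 𝔮 𝔮s Pl B U)) (h : SiteY i → ℝ) (hB : ∀ b, hBdY i h b ≠ 0 → b ∈ B) :
    cutMulY (hBdY i h) * (deltaLocQY i 𝔮 𝔮s U - Pl U) * GDirBY i 𝔮 𝔮s Pl B U * cutMulY (hBdY i h) = cutMulY (hBdY i h) * cutMulY (hBdY i h) :=
  cutMulY_op_dirInvY_cutMulY B hU (hBdY i h) hB

/-- ★★ **`hlocT` DISCHARGED**: `M_h G_□(U)(Δ_loc[𝔮](U) − Pl_□(U))M_h = M_h²` — the hypothesis `hlocT` of `eq3105QT_hT_ofLocalInverse`. (transposed reading — bookkeeping)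
[cite: Balaban1985BackgroundPropagators, (3.87)–(3.88) p.409, (3.105) p.414] -/
theorem hlocT_GDirBY (Pl : CfgY 𝔸 i → Module.End ℂ (FBondY i → 𝔸)) {B : Finset (FBondY i)} {U : CfgY 𝔸 i}
    (hU : IsUnit (padDeltaLocBY i 𝔮 𝔮s Pl B U)) (h : SiteY i → ℝ) (hB : ∀ b, hBdY i h b ≠ 0 → b ∈ B) :
    cutMulY (hBdY i h) * GDirBY i 𝔮 𝔮s Pl B U * (deltaLocQY i 𝔮 𝔮s U - Pl U) * cutMulY (hBdY i h) = cutMulY (hBdY i h) * cutMulY (hBdY i h) :=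
  cutMulY_dirInvY_op_cutMulY B hU (hBdY i h) hB

/-- LOCALITY IN `U` (support half of p. 410 l. 14–15): `G_□(U)` reads `U` only through the compression `Ω₀(Δ_loc[𝔮](U) − Pl_□(U))Ω₀`; two configurations whose
operators agree ON `B` on vector fields SUPPORTED IN `B` give the same `G_□`. (the kernel-agreement geometry that feeds this is junction-side)
[cite: Balaban1985BackgroundPropagators, p.410 («G′_□ depends on U restricted to Ω₀(□)»), p.394] -/
theorem GDirBY_congr_of_apply (Pl : CfgY 𝔸 i → Module.End ℂ (FBondY i → 𝔸)) (B : Finset (FBondY i)) {U V : CfgY 𝔸 i}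
    (h : ∀ A : FBondY i → 𝔸, (∀ b, b ∉ B → A b = 0) → ∀ b ∈ B, (deltaLocQY i 𝔮 𝔮s U - Pl U) A b = (deltaLocQY i 𝔮 𝔮s V - Pl V) A b) :
    GDirBY i 𝔮 𝔮s Pl B U = GDirBY i 𝔮 𝔮s Pl B V :=
  dirInvY_congr_of_apply B h

/-- the same from agreement of the compressions. [cite: Balaban1985BackgroundPropagators, p.410, p.394, bookkeeping] -/
theorem GDirBY_congr (Pl : CfgY 𝔸 i → Module.End ℂ (FBondY i → 𝔸)) (B : Finset (FBondY i)) {U V : CfgY 𝔸 i}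
    (h : indProjY B * (deltaLocQY i 𝔮 𝔮s U - Pl U) * indProjY B = indProjY B * (deltaLocQY i 𝔮 𝔮s V - Pl V) * indProjY B) :
    GDirBY i 𝔮 𝔮s Pl B U = GDirBY i 𝔮 𝔮s Pl B V :=
  dirInvY_congr h

/-- and the regime object is local in the same sense. [cite: Balaban1985BackgroundPropagators, p.410, p.394, bookkeeping] -/
theorem padDeltaLocBY_congr_of_apply (Pl : CfgY 𝔸 i → Module.End ℂ (FBondY i → 𝔸)) (B : Finset (FBondY i)) {U V : CfgY 𝔸 i}
    (h : ∀ A : FBondY i → 𝔸, (∀ b, b ∉ B → A b = 0) → ∀ b ∈ B, (deltaLocQY i 𝔮 𝔮s U - Pl U) A b = (deltaLocQY i 𝔮 𝔮s V - Pl V) A b) :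
    padDeltaLocBY i 𝔮 𝔮s Pl B U = padDeltaLocBY i 𝔮 𝔮s Pl B V :=
  dirPadY_congr_of_apply B h

/-- (c-2) THE (3.27)-FOR-THE-SEQUENCE FACE: at the print pin `Pl_□ = DP_□D* = DPDsY parS G′_□`, the operator inverted is def-Y's own `Δ_a[𝔮][G′_□](U)` (by the junction's
`deltaAQY_eq_loc_sub`). [cite: Balaban1985BackgroundPropagators, (3.26)–(3.27) p.395, p.409 l.3–5, p.415 («ζ_□DG′_□Q′*C_□Q′G′_□D* … = ζ_□DP_□D*»)] -/
theorem GDirBY_DPDsY (parS : SiteParY 𝔸 i) (Gp : SiteOpY 𝔸 i) (B : Finset (FBondY i)) (U : CfgY 𝔸 i) :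
    GDirBY i 𝔮 𝔮s (DPDsY i parS Gp) B U = dirInvY (indProjY B) (deltaAQY i 𝔮 𝔮s parS Gp U) := by
  rw [GDirBY_apply_eq, deltaAQY_eq_loc_sub]

/-- and its regime object is the padded compression of `Δ_a[𝔮][G′_□](U)`. [cite: Balaban1985BackgroundPropagators, (3.26) p.395, p.409 l.3–5, bookkeeping] -/
theorem padDeltaLocBY_DPDsY (parS : SiteParY 𝔸 i) (Gp : SiteOpY 𝔸 i) (B : Finset (FBondY i)) (U : CfgY 𝔸 i) :
    padDeltaLocBY i 𝔮 𝔮s (DPDsY i parS Gp) B U = dirPadY (indProjY B) (deltaAQY i 𝔮 𝔮s parS Gp U) := by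
  rw [padDeltaLocBY_eq, deltaAQY_eq_loc_sub]

/-- ★★★ **(3.105) AT PRINT's `G_□(U)` WITH `E_□ ≡ 0`**: the junction's exact-law identity `eq3105Q_hT_ofLocalInverse` with its local-inverse hypothesis DISCHARGED by
`hloc_GDirBY` — displayed: the cut-off row `hζ`, the (3.101) commutator row `hP1`, the bond-support rows `hB` and the regime `hU` (Cor. 3.6 for the sequences).
[cite: Balaban1985BackgroundPropagators, (3.105) p.414, p.409 l.3–5, (3.87) p.409, Cor. 3.6 p.408] -/
theorem eq3105Q_hT_GDirBY (parS : SiteParY 𝔸 i) (Gp : SiteOpY 𝔸 i) (U : CfgY 𝔸 i)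
    (ζ : ↥(cubes i.D.toDomains) → SiteY i → ℝ) (hζ : ∀ c z, hTY i c z ≠ 0 → ζ c z = 1)
    (Pl : ↥(cubes i.D.toDomains) → CfgY 𝔸 i → Module.End ℂ (FBondY i → 𝔸)) (P1l : ↥(cubes i.D.toDomains) → Module.End ℂ (FBondY i → 𝔸))
    (hP1 : ∀ c, Pl c U * cutMulY (hBdY i (hTY i c)) = cutMulY (hBdY i (hTY i c)) * Pl c U + P1l c)
    (B : ↥(cubes i.D.toDomains) → Finset (FBondY i)) (hB : ∀ c b, hBdY i (hTY i c) b ≠ 0 → b ∈ B c)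
    (hU : ∀ c, IsUnit (padDeltaLocBY i 𝔮 𝔮s (Pl c) (B c) U)) :
    deltaAQY i 𝔮 𝔮s parS Gp U * ∑ c, cutMulY (hBdY i (hTY i c)) * GDirBY i 𝔮 𝔮s (Pl c) (B c) U * cutMulY (hBdY i (hTY i c)) =
      1 - ∑ c, KhBQY i (hTY i c) 𝔮 𝔮s U * GDirBY i 𝔮 𝔮s (Pl c) (B c) U * cutMulY (hBdY i (hTY i c))
        - ∑ c, (1 - cutMulY (hBdY i (ζ c))) * DPDsY i parS Gp U *
            (cutMulY (hBdY i (hTY i c)) * GDirBY i 𝔮 𝔮s (Pl c) (B c) U * cutMulY (hBdY i (hTY i c)))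
        - ∑ c, cutMulY (hBdY i (ζ c)) * (DPDsY i parS Gp U - Pl c U) *
            (cutMulY (hBdY i (hTY i c)) * GDirBY i 𝔮 𝔮s (Pl c) (B c) U * cutMulY (hBdY i (hTY i c)))
        - ∑ c, cutMulY (hBdY i (ζ c)) * P1l c * GDirBY i 𝔮 𝔮s (Pl c) (B c) U * cutMulY (hBdY i (hTY i c)) :=
  eq3105Q_hT_ofLocalInverse i 𝔮 𝔮s parS Gp U ζ hζ (fun c => GDirBY i 𝔮 𝔮s (Pl c) (B c) U) (fun c => Pl c U) P1l hP1
    fun c => hloc_GDirBY i 𝔮 𝔮s (Pl c) (hU c) (hTY i c) (hB c)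

/-- ★★★ **THE TRANSPOSE OF (3.105) AT PRINT's `G_□(U)` WITH `E♯_□ ≡ 0`** (`eq3105QT_hT_ofLocalInverse` with `hlocT` discharged). (transposed reading — bookkeeping)
[cite: Balaban1985BackgroundPropagators, (3.105) p.414, p.409 l.3–5, (3.87) p.409, Cor. 3.6 p.408] -/
theorem eq3105QT_hT_GDirBY (parS : SiteParY 𝔸 i) (Gp : SiteOpY 𝔸 i) (U : CfgY 𝔸 i)
    (ζ : ↥(cubes i.D.toDomains) → SiteY i → ℝ) (hζ : ∀ c z, hTY i c z ≠ 0 → ζ c z = 1)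
    (Pl : ↥(cubes i.D.toDomains) → CfgY 𝔸 i → Module.End ℂ (FBondY i → 𝔸)) (P1l : ↥(cubes i.D.toDomains) → Module.End ℂ (FBondY i → 𝔸))
    (hP1 : ∀ c, Pl c U * cutMulY (hBdY i (hTY i c)) = cutMulY (hBdY i (hTY i c)) * Pl c U + P1l c)
    (B : ↥(cubes i.D.toDomains) → Finset (FBondY i)) (hB : ∀ c b, hBdY i (hTY i c) b ≠ 0 → b ∈ B c)
    (hU : ∀ c, IsUnit (padDeltaLocBY i 𝔮 𝔮s (Pl c) (B c) U)) :
    (∑ c, cutMulY (hBdY i (hTY i c)) * GDirBY i 𝔮 𝔮s (Pl c) (B c) U * cutMulY (hBdY i (hTY i c))) * deltaAQY i 𝔮 𝔮s parS Gp U =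
      1 + ∑ c, cutMulY (hBdY i (hTY i c)) * GDirBY i 𝔮 𝔮s (Pl c) (B c) U * KhBQY i (hTY i c) 𝔮 𝔮s U
        + ∑ c, cutMulY (hBdY i (hTY i c)) * GDirBY i 𝔮 𝔮s (Pl c) (B c) U * P1l c
        - ∑ c, cutMulY (hBdY i (hTY i c)) * GDirBY i 𝔮 𝔮s (Pl c) (B c) U * cutMulY (hBdY i (hTY i c)) *
            (cutMulY (hBdY i (ζ c)) * (DPDsY i parS Gp U - Pl c U))
        - ∑ c, cutMulY (hBdY i (hTY i c)) * GDirBY i 𝔮 𝔮s (Pl c) (B c) U * cutMulY (hBdY i (hTY i c)) *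
            ((1 - cutMulY (hBdY i (ζ c))) * DPDsY i parS Gp U) :=
  eq3105QT_hT_ofLocalInverse i 𝔮 𝔮s parS Gp U ζ hζ (fun c => GDirBY i 𝔮 𝔮s (Pl c) (B c) U) (fun c => Pl c U) P1l hP1
    fun c => hlocT_GDirBY i 𝔮 𝔮s (Pl c) (hU c) (hTY i c) (hB c)

/-- ★★★ **(3.105) AT THE PRINT PINS**: `Pl_□ = DP_□D* = DPDsY parS G′_□` and `P₁(∂h_□) = P1Y h_□ parS G′_□` for ANY cube-indexed family of site letters `G′_□`
(the (3.101) row is `DPDsY_comp_cutMulY` by name) — displayed: `hζ`, the bond-support rows, the regime.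
[cite: Balaban1985BackgroundPropagators, (3.105) p.414, (3.101) p.414, p.415, p.409 l.3–5, Cor. 3.6 p.408] -/
theorem eq3105Q_hT_GDirBY_DPDsY (parS : SiteParY 𝔸 i) (Gp : SiteOpY 𝔸 i) (U : CfgY 𝔸 i)
    (ζ : ↥(cubes i.D.toDomains) → SiteY i → ℝ) (hζ : ∀ c z, hTY i c z ≠ 0 → ζ c z = 1)
    (Gpc : ↥(cubes i.D.toDomains) → SiteOpY 𝔸 i)
    (B : ↥(cubes i.D.toDomains) → Finset (FBondY i)) (hB : ∀ c b, hBdY i (hTY i c) b ≠ 0 → b ∈ B c)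
    (hU : ∀ c, IsUnit (padDeltaLocBY i 𝔮 𝔮s (DPDsY i parS (Gpc c)) (B c) U)) :
    deltaAQY i 𝔮 𝔮s parS Gp U * ∑ c, cutMulY (hBdY i (hTY i c)) * GDirBY i 𝔮 𝔮s (DPDsY i parS (Gpc c)) (B c) U * cutMulY (hBdY i (hTY i c)) =
      1 - ∑ c, KhBQY i (hTY i c) 𝔮 𝔮s U * GDirBY i 𝔮 𝔮s (DPDsY i parS (Gpc c)) (B c) U * cutMulY (hBdY i (hTY i c))
        - ∑ c, (1 - cutMulY (hBdY i (ζ c))) * DPDsY i parS Gp U *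
            (cutMulY (hBdY i (hTY i c)) * GDirBY i 𝔮 𝔮s (DPDsY i parS (Gpc c)) (B c) U * cutMulY (hBdY i (hTY i c)))
        - ∑ c, cutMulY (hBdY i (ζ c)) * (DPDsY i parS Gp U - DPDsY i parS (Gpc c) U) *
            (cutMulY (hBdY i (hTY i c)) * GDirBY i 𝔮 𝔮s (DPDsY i parS (Gpc c)) (B c) U * cutMulY (hBdY i (hTY i c)))
        - ∑ c, cutMulY (hBdY i (ζ c)) * P1Y i (hTY i c) parS (Gpc c) U * GDirBY i 𝔮 𝔮s (DPDsY i parS (Gpc c)) (B c) U *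
            cutMulY (hBdY i (hTY i c)) :=
  eq3105Q_hT_GDirBY i 𝔮 𝔮s parS Gp U ζ hζ (fun c => DPDsY i parS (Gpc c)) (fun c => P1Y i (hTY i c) parS (Gpc c) U)
    (fun c => DPDsY_comp_cutMulY i (hTY i c) parS (Gpc c) U) B hB hU

/-! ### (c-1) The `U = 1` clause under a displayed matrix reading -/

/-- ★ **THE REGIME AT `U = 1`**: if `Δ_loc[𝔮](1) − Pl_□(1) = M♯` for a real bond matrix `M` (the `U = 1` rows of `∂`, `∂*`, the averaging pair and `Pl_□` — displayed) and a
real `K` inverts the compression of `M` to `B`, then `padDeltaLocBY … 1` is a unit. [cite: Balaban1985BackgroundPropagators, p.395 («if U = 1»), Cor. 3.5 p.407, p.409 l.3–5; Balaban1983RegularityDecay, (2.42) p.584] -/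
theorem isUnit_padDeltaLocBY_one (Pl : CfgY 𝔸 i → Module.End ℂ (FBondY i → 𝔸)) (B : Finset (FBondY i)) {M K : Matrix (FBondY i) (FBondY i) ℝ}
    (hT1 : deltaLocQY i 𝔮 𝔮s (fun _ _ => 1) - Pl (fun _ _ => 1) = liftOpY 𝔸 M)
    (hK : M.submatrix (fun v : ↥B => (v : FBondY i)) (fun v : ↥B => (v : FBondY i)) *
      K.submatrix (fun v : ↥B => (v : FBondY i)) (fun v : ↥B => (v : FBondY i)) = 1) :
    IsUnit (padDeltaLocBY i 𝔮 𝔮s Pl B (fun _ _ => (1 : 𝔸ˣ))) := by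
  rw [padDeltaLocBY_eq, hT1]
  exact isUnit_dirPadY_indProjY_liftOpY B hK

/-- ★★ **THE `U = 1` CLAUSE FOR `G_□`**: under the same displayed reading, `G_□(1) = (𝟙_B K 𝟙_B)♯`.
[cite: Balaban1985BackgroundPropagators, p.395 («if U = 1»), Cor. 3.5 p.407, p.409 l.3–5; Balaban1983RegularityDecay, (2.42) p.584] -/
theorem GDirBY_one_eq_liftOpY (Pl : CfgY 𝔸 i → Module.End ℂ (FBondY i → 𝔸)) (B : Finset (FBondY i)) {M K : Matrix (FBondY i) (FBondY i) ℝ}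
    (hT1 : deltaLocQY i 𝔮 𝔮s (fun _ _ => 1) - Pl (fun _ _ => 1) = liftOpY 𝔸 M)
    (hK : M.submatrix (fun v : ↥B => (v : FBondY i)) (fun v : ↥B => (v : FBondY i)) *
      K.submatrix (fun v : ↥B => (v : FBondY i)) (fun v : ↥B => (v : FBondY i)) = 1) :
    GDirBY i 𝔮 𝔮s Pl B (fun _ _ => 1) = liftOpY 𝔸 (indDiagY B * K * indDiagY B) := by
  rw [GDirBY_apply_eq, hT1]
  exact dirInvY_indProjY_liftOpY B hK

/-- its product-form reading: `G_□(1)(f ⊗ E)(b) = (Σ_{b′∈B} K b b′ f b′) E` on `B`, `0` off `B`.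
[cite: Balaban1985BackgroundPropagators, p.395, p.409 l.3–5; Balaban1983RegularityDecay, (2.42) p.584] -/
theorem GDirBY_one_liftY_apply (Pl : CfgY 𝔸 i → Module.End ℂ (FBondY i → 𝔸)) (B : Finset (FBondY i)) {M K : Matrix (FBondY i) (FBondY i) ℝ}
    (hT1 : deltaLocQY i 𝔮 𝔮s (fun _ _ => 1) - Pl (fun _ _ => 1) = liftOpY 𝔸 M)
    (hK : M.submatrix (fun v : ↥B => (v : FBondY i)) (fun v : ↥B => (v : FBondY i)) *
      K.submatrix (fun v : ↥B => (v : FBondY i)) (fun v : ↥B => (v : FBondY i)) = 1)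
    (f : FBondY i → ℝ) (E : 𝔸) (b : FBondY i) :
    GDirBY i 𝔮 𝔮s Pl B (fun _ _ => 1) (liftY f E) b = if b ∈ B then (((∑ b' ∈ B, K b b' * f b' : ℝ)) : ℂ) • E else 0 := by
  rw [GDirBY_one_eq_liftOpY i 𝔮 𝔮s Pl B hT1 hK, liftOpY_liftY, liftY_apply, compr_mulVec_apply]
  split_ifs <;> simp

end Bond

end Literature.MathematicalPhysics.QuantumFieldTheory.Balaban1983to89.Node00.OpsYCubeDirInverseBond
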